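import Mathlib
import HarnessLib
import Summits.KontsevichZagierPeriods.Zeta5Search.DougallFullRange
import Summits.KontsevichZagierPeriods.Zeta5Search.BarnesMellin
import Literature.NumberTheory.LFunctions.RiemannXiOrderProofs

/-!
# ζ(5) search — the series of Zudilin's (9) with COMPLEX co-parameters: estimates and holomorphy in one slot
(cell `pub-zeta5`, ct-1 g26)

HONEST FRAMING: systematic search; no irrationality claim unless kernel-certified.  Estimates and holomorphy statements for a
series of Gamma values; nothing here is an irrationality result; no named fact of the tree is discharged.

Brick B5g (first half) of `HOME/ct-1/g26/VWP-BLUEPRINT.md`: Zudilin's induction (13)–(14) needs (9) at COMPLEX shifted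
parameters.  `DougallParameterHolomorphy` / `DougallFullRange` treat the slot `h₁` with REAL co-parameters; here the
co-parameters `h₀, h₂, h₃` are complex with positive real parts, the majorant being the same real four-Gamma term taken at
the real parts:
* `norm_inv_Gamma_add_nat_le` (`‖Γ(ζ+μ)⁻¹‖ ≤ ‖Γ(ζ)⁻¹‖/(Re ζ)_μ`; with the tree's `norm_Gamma_le_Gamma_re`),
  `norm_add_two_mul_le` (`‖h₀+2μ‖ ≤ max(1,‖h₀‖/Re h₀)·(Re h₀+2μ)`);
* `norm_coeff_le` — the three-Gamma coefficient at complex `h₀, h₂, h₃` is bounded by a constant times the real one at the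
  real parts;
* `differentiableOn_series_cparam` — the series of (9) is holomorphic in `w = h₁` on `{0 < Re w < 1+Re h₀−Re h₂−Re h₃}` for
  complex co-parameters; `differentiableOn_gammaSide_cparam` — so is the Gamma side.
Theorems only (no new definitions).
-/

noncomputable section

namespace Summit.KontsevichZagierPeriods.Zeta5Search.DougallComplexParameters

open Finset Filter Set Metric
open Summit.KontsevichZagierPeriods.Zeta5Search.HypergeometricWhipple (rf rf_zero rf_succ)
open Summit.KontsevichZagierPeriods.Zeta5Search.DougallTerminatingGamma (Gamma_add_nat_eq_mul_rf rf_ne_zero)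
open Summit.KontsevichZagierPeriods.Zeta5Search.DougallCoefficientBounds (Gamma_add_nat_eq)
open Summit.KontsevichZagierPeriods.Zeta5Search.DougallParameterHolomorphy (summable_fourGamma prod_re_le_norm_rf
  norm_Gamma_add_nat_le)
open Summit.KontsevichZagierPeriods.Zeta5Search.BarnesMellin (ne_neg_nat_of_re_pos)
open Literature.NumberTheory.LFunctions (norm_Gamma_le_Gamma_re)

/-! ### 1. Elementary estimates at complex arguments -/

/-- `‖Γ(ζ+μ)⁻¹‖ ≤ ‖Γ(ζ)⁻¹‖ / ∏_{i<μ} (Re ζ + i)` for `Re ζ > 0`. -/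
theorem norm_inv_Gamma_add_nat_le {ζ : ℂ} (hζ : 0 < ζ.re) (μ : ℕ) :
    ‖(Complex.Gamma (ζ + μ))⁻¹‖ ≤ ‖(Complex.Gamma ζ)⁻¹‖ / ∏ i ∈ range μ, (ζ.re + i) := by
  have hpos : 0 < ∏ i ∈ range μ, (ζ.re + i) := Finset.prod_pos fun i _ => by positivity
  rw [Gamma_add_nat_eq_mul_rf (ne_neg_nat_of_re_pos hζ) μ, mul_inv, norm_mul, norm_inv (rf _ _), ← div_eq_mul_inv]
  exact div_le_div_of_nonneg_left (norm_nonneg _) hpos (prod_re_le_norm_rf ζ hζ.le μ)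

/-- `‖h₀+2μ‖ ≤ max(1, ‖h₀‖/Re h₀)·(Re h₀+2μ)` for `Re h₀ > 0`. -/
theorem norm_add_two_mul_le (h₀ : ℂ) (hx : 0 < h₀.re) (μ : ℕ) :
    ‖h₀ + 2 * μ‖ ≤ max 1 (‖h₀‖ / h₀.re) * (h₀.re + 2 * μ) := by
  have hK1 : 1 ≤ max 1 (‖h₀‖ / h₀.re) := le_max_left _ _
  have hK2 : ‖h₀‖ / h₀.re ≤ max 1 (‖h₀‖ / h₀.re) := le_max_right _ _
  have h1 : ‖h₀‖ ≤ max 1 (‖h₀‖ / h₀.re) * h₀.re := by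
    rw [← div_le_iff₀ hx]; exact hK2
  have h2 : (2 * μ : ℝ) ≤ max 1 (‖h₀‖ / h₀.re) * (2 * μ) := by
    nlinarith [(μ.cast_nonneg : (0 : ℝ) ≤ μ)]
  calc ‖h₀ + 2 * μ‖ ≤ ‖h₀‖ + ‖(2 * μ : ℂ)‖ := norm_add_le _ _
    _ = ‖h₀‖ + 2 * μ := by
        rw [show (2 * μ : ℂ) = ((2 * μ : ℝ) : ℂ) by push_cast; ring, Complex.norm_real,
          Real.norm_of_nonneg (by positivity)]
    _ ≤ _ := by rw [mul_add]; exact add_le_add h1 h2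

/-- **The three-Gamma coefficient at complex parameters against the real one**: for `Re h₀, Re h₂, Re h₃ > 0` and
`Re h₂, Re h₃ < Re h₀ + 1`,
`‖(h₀+2μ)Γ(h₀+μ)Γ(h₂+μ)Γ(h₃+μ)/(Γ(μ+1)Γ(h₀−h₂+1+μ)Γ(h₀−h₃+1+μ))‖
 ≤ K(x₀+2μ)Γ(x₀+μ)Γ(x₂+μ)Γ(x₃+μ)/(Γ(μ+1)·‖Γ(h₀−h₂+1)‖(x₀−x₂+1)_μ·‖Γ(h₀−h₃+1)‖(x₀−x₃+1)_μ)`, `x = Re h`, `K = max(1,‖h₀‖/x₀)`. -/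
theorem norm_coeff_le (h₀ h₂ h₃ : ℂ) (hx₀ : 0 < h₀.re) (hx₂ : 0 < h₂.re) (hx₃ : 0 < h₃.re)
    (h2' : h₂.re < h₀.re + 1) (h3' : h₃.re < h₀.re + 1) (μ : ℕ) :
    ‖(h₀ + 2 * μ) * (Complex.Gamma (h₀ + μ) * Complex.Gamma (h₂ + μ) * Complex.Gamma (h₃ + μ)) /
        (Complex.Gamma ((μ : ℂ) + 1) * Complex.Gamma (h₀ - h₂ + 1 + μ) * Complex.Gamma (h₀ - h₃ + 1 + μ))‖ ≤
      (max 1 (‖h₀‖ / h₀.re) * (h₀.re + 2 * μ) *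
          (Real.Gamma (h₀.re + μ) * Real.Gamma (h₂.re + μ) * Real.Gamma (h₃.re + μ))) /
        (Real.Gamma ((μ : ℝ) + 1) * (‖Complex.Gamma (h₀ - h₂ + 1)‖ * ∏ i ∈ range μ, (h₀.re - h₂.re + 1 + i)) *
          (‖Complex.Gamma (h₀ - h₃ + 1)‖ * ∏ i ∈ range μ, (h₀.re - h₃.re + 1 + i))) := by
  have hζ₂ : 0 < (h₀ - h₂ + 1).re := by simp; linarith
  have hζ₃ : 0 < (h₀ - h₃ + 1).re := by simp; linarith
  -- numerator
  have e0 : ‖Complex.Gamma (h₀ + μ)‖ ≤ Real.Gamma (h₀.re + μ) := by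
    simpa using norm_Gamma_le_Gamma_re (s := h₀ + μ) (by simp; positivity)
  have e2 : ‖Complex.Gamma (h₂ + μ)‖ ≤ Real.Gamma (h₂.re + μ) := by
    simpa using norm_Gamma_le_Gamma_re (s := h₂ + μ) (by simp; positivity)
  have e3 : ‖Complex.Gamma (h₃ + μ)‖ ≤ Real.Gamma (h₃.re + μ) := by
    simpa using norm_Gamma_le_Gamma_re (s := h₃ + μ) (by simp; positivity)
  have G0 := Real.Gamma_pos_of_pos (show 0 < h₀.re + μ by positivity)
  have G2 := Real.Gamma_pos_of_pos (show 0 < h₂.re + μ by positivity)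
  have hN : ‖(h₀ + 2 * μ) * (Complex.Gamma (h₀ + μ) * Complex.Gamma (h₂ + μ) * Complex.Gamma (h₃ + μ))‖ ≤
      max 1 (‖h₀‖ / h₀.re) * (h₀.re + 2 * μ) *
        (Real.Gamma (h₀.re + μ) * Real.Gamma (h₂.re + μ) * Real.Gamma (h₃.re + μ)) := by
    rw [norm_mul, norm_mul, norm_mul]
    refine mul_le_mul (norm_add_two_mul_le h₀ hx₀ μ) ?_ (by positivity) (by positivity)
    exact mul_le_mul (mul_le_mul e0 e2 (norm_nonneg _) G0.le) e3 (norm_nonneg _) (by positivity)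
  -- denominator
  have d1 : ‖Complex.Gamma ((μ : ℂ) + 1)‖ = Real.Gamma ((μ : ℝ) + 1) := by
    rw [Complex.Gamma_nat_eq_factorial, Real.Gamma_nat_eq_factorial, Complex.norm_natCast]
  have dζ : ∀ {ζ : ℂ}, 0 < ζ.re →
      ‖Complex.Gamma ζ‖ * ∏ i ∈ range μ, (ζ.re + i) ≤ ‖Complex.Gamma (ζ + μ)‖ := by
    intro ζ hζ
    rw [Gamma_add_nat_eq_mul_rf (ne_neg_nat_of_re_pos hζ) μ, norm_mul]
    exact mul_le_mul_of_nonneg_left (prod_re_le_norm_rf ζ hζ.le μ) (norm_nonneg _)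
  have d2 := dζ hζ₂
  have d3 := dζ hζ₃
  simp only [Complex.add_re, Complex.sub_re, Complex.one_re] at d2 d3
  have P2 : 0 < ∏ i ∈ range μ, (h₀.re - h₂.re + 1 + i) := Finset.prod_pos fun i _ => by linarith [i.cast_nonneg (α := ℝ)]
  have P3 : 0 < ∏ i ∈ range μ, (h₀.re - h₃.re + 1 + i) := Finset.prod_pos fun i _ => by linarith [i.cast_nonneg (α := ℝ)]
  have nζ₂ : 0 < ‖Complex.Gamma (h₀ - h₂ + 1)‖ := norm_pos_iff.2 (Complex.Gamma_ne_zero (ne_neg_nat_of_re_pos hζ₂))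
  have nζ₃ : 0 < ‖Complex.Gamma (h₀ - h₃ + 1)‖ := norm_pos_iff.2 (Complex.Gamma_ne_zero (ne_neg_nat_of_re_pos hζ₃))
  have G1 := Real.Gamma_pos_of_pos (show 0 < (μ : ℝ) + 1 by positivity)
  have hD : Real.Gamma ((μ : ℝ) + 1) * (‖Complex.Gamma (h₀ - h₂ + 1)‖ * ∏ i ∈ range μ, (h₀.re - h₂.re + 1 + i)) *
      (‖Complex.Gamma (h₀ - h₃ + 1)‖ * ∏ i ∈ range μ, (h₀.re - h₃.re + 1 + i)) ≤
      ‖Complex.Gamma ((μ : ℂ) + 1) * Complex.Gamma (h₀ - h₂ + 1 + μ) * Complex.Gamma (h₀ - h₃ + 1 + μ)‖ := by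
    rw [norm_mul, norm_mul, d1]
    exact mul_le_mul (mul_le_mul_of_nonneg_left d2 G1.le) d3 (by positivity) (by positivity)
  rw [norm_div]
  exact div_le_div₀ (by positivity) hN (by positivity) hD

/-! ### 2. Holomorphy in the slot `w = h₁` with complex co-parameters -/

/-- Each term is holomorphic in `w` on `0 < Re w < Re h₀ + 1` (complex co-parameters with `Re h₂, Re h₃ < Re h₀ + 1`). -/
theorem differentiableAt_term_cparam (h₀ h₂ h₃ : ℂ) (h2' : h₂.re < h₀.re + 1) (h3' : h₃.re < h₀.re + 1) (μ : ℕ)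
    {w : ℂ} (hw : 0 < w.re) (hw' : w.re < h₀.re + 1) :
    DifferentiableAt ℂ (fun w : ℂ => (h₀ + 2 * μ) *
        (Complex.Gamma (h₀ + μ) * Complex.Gamma (w + μ) * Complex.Gamma (h₂ + μ) * Complex.Gamma (h₃ + μ)) /
        (Complex.Gamma ((μ : ℂ) + 1) * Complex.Gamma (h₀ - w + 1 + μ) * Complex.Gamma (h₀ - h₂ + 1 + μ) *
          Complex.Gamma (h₀ - h₃ + 1 + μ))) w := by
  have d1 : DifferentiableAt ℂ (fun w : ℂ => Complex.Gamma (w + μ)) w :=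
    (Complex.differentiableAt_Gamma _ (ne_neg_nat_of_re_pos (by simp; positivity))).comp w
      (differentiableAt_id.add_const _)
  have d2 : DifferentiableAt ℂ (fun w : ℂ => Complex.Gamma (h₀ - w + 1 + μ)) w :=
    (Complex.differentiableAt_Gamma _ (ne_neg_nat_of_re_pos (by simp; linarith [μ.cast_nonneg (α := ℝ)]))).comp w
      ((((differentiableAt_const _).sub differentiableAt_id).add_const _).add_const _)
  refine DifferentiableAt.div ?_ ?_ ?_
  · exact ((((differentiableAt_const _).mul d1).mul_const _).mul_const _).const_mul _
  · exact (((differentiableAt_const _).mul d2).mul_const _).mul_const _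
  · have g1 : Complex.Gamma ((μ : ℂ) + 1) ≠ 0 := Complex.Gamma_ne_zero (ne_neg_nat_of_re_pos (by simp; positivity))
    have g2 : Complex.Gamma (h₀ - w + 1 + μ) ≠ 0 :=
      Complex.Gamma_ne_zero (ne_neg_nat_of_re_pos (by simp; linarith [μ.cast_nonneg (α := ℝ)]))
    have g3 : Complex.Gamma (h₀ - h₂ + 1 + μ) ≠ 0 :=
      Complex.Gamma_ne_zero (ne_neg_nat_of_re_pos (by simp; linarith [μ.cast_nonneg (α := ℝ)]))
    have g4 : Complex.Gamma (h₀ - h₃ + 1 + μ) ≠ 0 :=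
      Complex.Gamma_ne_zero (ne_neg_nat_of_re_pos (by simp; linarith [μ.cast_nonneg (α := ℝ)]))
    exact mul_ne_zero (mul_ne_zero (mul_ne_zero g1 g2) g3) g4

/-- **Holomorphy of the series of (9) in `w = h₁` with complex co-parameters** `h₀, h₂, h₃` (`Re > 0`) on
`D = {0 < Re w < 1 + Re h₀ − Re h₂ − Re h₃}`: Weierstrass M-test on small balls against the real four-Gamma term at the real
parts (`summable_fourGamma`), via `norm_coeff_le`, `‖Γ(w+μ)‖ ≤ Γ(Re w)(Re w)_μ` and `‖Γ(h₀+1−w+μ)⁻¹‖ ≤ ‖Γ(h₀+1−w)⁻¹‖/(Re h₀+1−Re w)_μ`. -/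
theorem differentiableOn_series_cparam (h₀ h₂ h₃ : ℂ) (hx₀ : 0 < h₀.re) (hx₂ : 0 < h₂.re) (hx₃ : 0 < h₃.re) :
    DifferentiableOn ℂ (fun w : ℂ => ∑' μ : ℕ, (h₀ + 2 * μ) *
        (Complex.Gamma (h₀ + μ) * Complex.Gamma (w + μ) * Complex.Gamma (h₂ + μ) * Complex.Gamma (h₃ + μ)) /
        (Complex.Gamma ((μ : ℂ) + 1) * Complex.Gamma (h₀ - w + 1 + μ) * Complex.Gamma (h₀ - h₂ + 1 + μ) *
          Complex.Gamma (h₀ - h₃ + 1 + μ)))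
      {w : ℂ | 0 < w.re ∧ w.re < 1 + h₀.re - h₂.re - h₃.re} := by
  intro w₀ hw₀
  obtain ⟨hw₀, hw₀'⟩ := hw₀
  have h2' : h₂.re < h₀.re + 1 := by linarith
  have h3' : h₃.re < h₀.re + 1 := by linarith
  set δ : ℝ := min (w₀.re / 2) ((1 + h₀.re - h₂.re - h₃.re - w₀.re) / 2) with hδ
  have hδpos : 0 < δ := lt_min (by linarith) (by linarith)
  have hδ1 : δ ≤ w₀.re / 2 := min_le_left _ _
  have hδ2 : δ ≤ (1 + h₀.re - h₂.re - h₃.re - w₀.re) / 2 := min_le_right _ _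
  set xl : ℝ := w₀.re - δ with hxl
  set xu : ℝ := w₀.re + δ with hxu
  have hxl0 : 0 < xl := by rw [hxl]; linarith
  have hxu1 : xu + h₂.re + h₃.re < 1 + h₀.re := by rw [hxu]; linarith
  have hre : ∀ w ∈ ball w₀ δ, xl < w.re ∧ w.re < xu := by
    intro w hw
    rw [mem_ball, dist_eq_norm] at hw
    have h1 := Complex.abs_re_le_norm (w - w₀)
    simp only [Complex.sub_re] at h1
    have h2 := abs_lt.1 (lt_of_le_of_lt h1 hw)
    constructor
    · rw [hxl]; linarith [h2.1]
    · rw [hxu]; linarith [h2.2]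
  obtain ⟨MΓ, hMΓ⟩ : ∃ M : ℝ, ∀ x ∈ Icc xl xu, Real.Gamma x ≤ M := by
    have hc : ContinuousOn Real.Gamma (Icc xl xu) := fun x hx =>
      (Real.differentiableAt_Gamma fun m => by
        have : 0 < x := lt_of_lt_of_le hxl0 hx.1
        intro h; rw [h] at this
        have := m.cast_nonneg (α := ℝ); linarith).continuousAt.continuousWithinAt
    obtain ⟨M, hM⟩ := isCompact_Icc.exists_bound_of_continuousOn hc
    exact ⟨M, fun x hx => (le_abs_self _).trans (by simpa [Real.norm_eq_abs] using hM x hx)⟩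
  have hMΓ0 : 0 ≤ MΓ :=
    (Real.Gamma_pos_of_pos hw₀).le.trans (hMΓ w₀.re ⟨by rw [hxl]; linarith, by rw [hxu]; linarith⟩)
  obtain ⟨Mw, hMw⟩ : ∃ M : ℝ, ∀ w ∈ closedBall w₀ δ, ‖(Complex.Gamma (h₀ - w + 1))⁻¹‖ ≤ M := by
    have hd : Differentiable ℂ fun w : ℂ => h₀ - w + 1 := by fun_prop
    have hc : Continuous fun w : ℂ => (Complex.Gamma (h₀ - w + 1))⁻¹ :=
      (Complex.differentiable_one_div_Gamma.comp hd).continuous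
    obtain ⟨M, hM⟩ := (isCompact_closedBall w₀ δ).exists_bound_of_continuousOn hc.continuousOn
    exact ⟨M, hM⟩
  have hMw0 : 0 ≤ Mw := (norm_nonneg _).trans (hMw w₀ (mem_closedBall_self hδpos.le))
  -- the majorant: (bound of `norm_coeff_le`) · MΓ (xu)_μ · Mw / (x₀−xu+1)_μ
  set K : ℝ := max 1 (‖h₀‖ / h₀.re) with hK
  set CF : ℕ → ℝ := fun μ => (K * (h₀.re + 2 * μ) *
      (Real.Gamma (h₀.re + μ) * Real.Gamma (h₂.re + μ) * Real.Gamma (h₃.re + μ))) /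
    (Real.Gamma ((μ : ℝ) + 1) * (‖Complex.Gamma (h₀ - h₂ + 1)‖ * ∏ i ∈ range μ, (h₀.re - h₂.re + 1 + i)) *
      (‖Complex.Gamma (h₀ - h₃ + 1)‖ * ∏ i ∈ range μ, (h₀.re - h₃.re + 1 + i))) with hCF
  have nζ₂ : 0 < ‖Complex.Gamma (h₀ - h₂ + 1)‖ :=
    norm_pos_iff.2 (Complex.Gamma_ne_zero (ne_neg_nat_of_re_pos (by simp; linarith)))
  have nζ₃ : 0 < ‖Complex.Gamma (h₀ - h₃ + 1)‖ :=
    norm_pos_iff.2 (Complex.Gamma_ne_zero (ne_neg_nat_of_re_pos (by simp; linarith)))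
  have hCFnn : ∀ μ : ℕ, 0 ≤ CF μ := by
    intro μ
    have P2 : 0 < ∏ i ∈ range μ, (h₀.re - h₂.re + 1 + i) :=
      Finset.prod_pos fun i _ => by linarith [i.cast_nonneg (α := ℝ)]
    have P3 : 0 < ∏ i ∈ range μ, (h₀.re - h₃.re + 1 + i) :=
      Finset.prod_pos fun i _ => by linarith [i.cast_nonneg (α := ℝ)]
    rw [hCF]
    positivity
  set u : ℕ → ℝ := fun μ => CF μ * ((MΓ * ∏ i ∈ range μ, (xu + i)) *
      (Mw / ∏ i ∈ range μ, (h₀.re - xu + 1 + i))) with hu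
  have hsum : Summable u := by
    have h4 := (summable_fourGamma h₀.re xu h₂.re h₃.re hx₀ (by linarith) hx₂ hx₃ (by linarith)).mul_left
      (K * MΓ * Mw * Real.Gamma (h₀.re - xu + 1) * Real.Gamma (h₀.re - h₂.re + 1) * Real.Gamma (h₀.re - h₃.re + 1) /
        (Real.Gamma xu * ‖Complex.Gamma (h₀ - h₂ + 1)‖ * ‖Complex.Gamma (h₀ - h₃ + 1)‖))
    refine h4.congr fun μ => ?_
    have hΓxu : Real.Gamma xu ≠ 0 := (Real.Gamma_pos_of_pos (by linarith)).ne'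
    have hΓ1 : Real.Gamma (h₀.re - xu + 1) ≠ 0 := (Real.Gamma_pos_of_pos (by linarith)).ne'
    have hΓ2 : Real.Gamma (h₀.re - h₂.re + 1) ≠ 0 := (Real.Gamma_pos_of_pos (by linarith)).ne'
    have hΓ3 : Real.Gamma (h₀.re - h₃.re + 1) ≠ 0 := (Real.Gamma_pos_of_pos (by linarith)).ne'
    have P1 : ∏ i ∈ range μ, (h₀.re - xu + 1 + i) ≠ 0 :=
      (Finset.prod_pos fun i _ => by linarith [i.cast_nonneg (α := ℝ)]).ne'
    have P2 : ∏ i ∈ range μ, (h₀.re - h₂.re + 1 + i) ≠ 0 :=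
      (Finset.prod_pos fun i _ => by linarith [i.cast_nonneg (α := ℝ)]).ne'
    have P3 : ∏ i ∈ range μ, (h₀.re - h₃.re + 1 + i) ≠ 0 :=
      (Finset.prod_pos fun i _ => by linarith [i.cast_nonneg (α := ℝ)]).ne'
    rw [hu, hCF]
    simp only
    rw [Gamma_add_nat_eq xu (by linarith) μ, Gamma_add_nat_eq (h₀.re - xu + 1) (by linarith) μ,
      Gamma_add_nat_eq (h₀.re - h₂.re + 1) (by linarith) μ, Gamma_add_nat_eq (h₀.re - h₃.re + 1) (by linarith) μ]
    field_simp
  have hdiff : DifferentiableOn ℂ (fun w : ℂ => ∑' μ : ℕ, (h₀ + 2 * μ) *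
        (Complex.Gamma (h₀ + μ) * Complex.Gamma (w + μ) * Complex.Gamma (h₂ + μ) * Complex.Gamma (h₃ + μ)) /
        (Complex.Gamma ((μ : ℂ) + 1) * Complex.Gamma (h₀ - w + 1 + μ) * Complex.Gamma (h₀ - h₂ + 1 + μ) *
          Complex.Gamma (h₀ - h₃ + 1 + μ))) (ball w₀ δ) := by
    refine Complex.differentiableOn_tsum_of_summable_norm hsum (fun μ w hw => ?_) isOpen_ball (fun μ w hw => ?_)
    · obtain ⟨h1, h2⟩ := hre w hw
      exact (differentiableAt_term_cparam h₀ h₂ h₃ h2' h3' μ (by linarith) (by linarith)).differentiableWithinAt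
    · obtain ⟨h1, h2⟩ := hre w hw
      have hwpos : 0 < w.re := by linarith
      have eT : (h₀ + 2 * μ) *
          (Complex.Gamma (h₀ + μ) * Complex.Gamma (w + μ) * Complex.Gamma (h₂ + μ) * Complex.Gamma (h₃ + μ)) /
          (Complex.Gamma ((μ : ℂ) + 1) * Complex.Gamma (h₀ - w + 1 + μ) * Complex.Gamma (h₀ - h₂ + 1 + μ) *
            Complex.Gamma (h₀ - h₃ + 1 + μ)) =
        ((h₀ + 2 * μ) * (Complex.Gamma (h₀ + μ) * Complex.Gamma (h₂ + μ) * Complex.Gamma (h₃ + μ)) /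
          (Complex.Gamma ((μ : ℂ) + 1) * Complex.Gamma (h₀ - h₂ + 1 + μ) * Complex.Gamma (h₀ - h₃ + 1 + μ))) *
          (Complex.Gamma (w + μ) * (Complex.Gamma (h₀ - w + 1 + μ))⁻¹) := by
        rw [div_eq_mul_inv, div_eq_mul_inv]
        ring
      rw [eT, norm_mul, norm_mul]
      have b0 := norm_coeff_le h₀ h₂ h₃ hx₀ hx₂ hx₃ h2' h3' μ
      have b1 : ‖Complex.Gamma (w + μ)‖ ≤ MΓ * ∏ i ∈ range μ, (xu + i) := by
        refine (norm_Gamma_add_nat_le hwpos μ).trans ?_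
        refine mul_le_mul (hMΓ w.re ⟨h1.le, h2.le⟩) (Finset.prod_le_prod (fun i _ => by positivity)
          fun i _ => by linarith) (Finset.prod_nonneg fun i _ => by positivity) hMΓ0
      have hPu : 0 < ∏ i ∈ range μ, (h₀.re - xu + 1 + i) :=
        Finset.prod_pos fun i _ => by linarith [i.cast_nonneg (α := ℝ)]
      have b2 : ‖(Complex.Gamma (h₀ - w + 1 + μ))⁻¹‖ ≤ Mw / ∏ i ∈ range μ, (h₀.re - xu + 1 + i) := by
        have hζ : 0 < (h₀ - w + 1).re := by simp; linarith
        refine (norm_inv_Gamma_add_nat_le hζ μ).trans ?_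
        simp only [Complex.add_re, Complex.sub_re, Complex.one_re]
        exact div_le_div₀ hMw0 (hMw w (ball_subset_closedBall hw)) hPu
          (Finset.prod_le_prod (fun i _ => by linarith [i.cast_nonneg (α := ℝ)]) fun i _ => by linarith)
      rw [hu]
      exact mul_le_mul b0 (mul_le_mul b1 b2 (norm_nonneg _)
        (mul_nonneg hMΓ0 (Finset.prod_nonneg fun i _ => by positivity))) (by positivity) (hCFnn μ)
  exact (hdiff.differentiableAt (isOpen_ball.mem_nhds (mem_ball_self hδpos))).differentiableWithinAt

/-- The Gamma side of (9) is holomorphic in `w = h₁` on `D` for complex co-parameters (`Re h₂, Re h₃ > 0`). -/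
theorem differentiableOn_gammaSide_cparam (h₀ h₂ h₃ : ℂ) (hx₂ : 0 < h₂.re) (hx₃ : 0 < h₃.re) :
    DifferentiableOn ℂ (fun w : ℂ => Complex.Gamma w * Complex.Gamma h₂ * Complex.Gamma h₃ *
        Complex.Gamma (h₀ - w - h₂ - h₃ + 1) /
        (Complex.Gamma (h₀ - w - h₂ + 1) * Complex.Gamma (h₀ - w - h₃ + 1) * Complex.Gamma (h₀ - h₂ - h₃ + 1)))
      {w : ℂ | 0 < w.re ∧ w.re < 1 + h₀.re - h₂.re - h₃.re} := by
  intro w hw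
  obtain ⟨hw, hw'⟩ := hw
  have dw : DifferentiableAt ℂ Complex.Gamma w := Complex.differentiableAt_Gamma _ (ne_neg_nat_of_re_pos hw)
  have dN : DifferentiableAt ℂ (fun w : ℂ => Complex.Gamma (h₀ - w - h₂ - h₃ + 1)) w :=
    (Complex.differentiableAt_Gamma _ (ne_neg_nat_of_re_pos (by simp; linarith))).comp w
      (((((differentiableAt_const _).sub differentiableAt_id).sub_const _).sub_const _).add_const _)
  have dD1 : DifferentiableAt ℂ (fun w : ℂ => Complex.Gamma (h₀ - w - h₂ + 1)) w :=
    (Complex.differentiableAt_Gamma _ (ne_neg_nat_of_re_pos (by simp; linarith))).comp w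
      ((((differentiableAt_const _).sub differentiableAt_id).sub_const _).add_const _)
  have dD2 : DifferentiableAt ℂ (fun w : ℂ => Complex.Gamma (h₀ - w - h₃ + 1)) w :=
    (Complex.differentiableAt_Gamma _ (ne_neg_nat_of_re_pos (by simp; linarith))).comp w
      ((((differentiableAt_const _).sub differentiableAt_id).sub_const _).add_const _)
  refine (DifferentiableAt.div (((dw.mul_const _).mul_const _).mul dN) ((dD1.mul dD2).mul_const _)
    ?_).differentiableWithinAt
  have g1 : Complex.Gamma (h₀ - w - h₂ + 1) ≠ 0 := Complex.Gamma_ne_zero (ne_neg_nat_of_re_pos (by simp; linarith))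
  have g2 : Complex.Gamma (h₀ - w - h₃ + 1) ≠ 0 := Complex.Gamma_ne_zero (ne_neg_nat_of_re_pos (by simp; linarith))
  have g3 : Complex.Gamma (h₀ - h₂ - h₃ + 1) ≠ 0 := Complex.Gamma_ne_zero (ne_neg_nat_of_re_pos (by simp; linarith))
  exact mul_ne_zero (mul_ne_zero g1 g2) g3

end Summit.KontsevichZagierPeriods.Zeta5Search.DougallComplexParameters

end
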